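import Summits.AtomisticToContinuum.HydrodynamicLimit.Theorems.StiffCollisionalRelaxationAprioriBoundsMesoOnePtShift
import HarnessLib

/-!
# Quantitative truncated two-point function of the canonical hard-sphere gas with a slowly varying
# one-body law (s = 0 inhomogeneous rung of stub `stub_mesoVariance`, line `meso-chebyshev-window`,
# crux `AprioriBounds`, stmt-AtomisticToContinuum-14827) — file 2 of 2

Helper file (`--supports stmt-AtomisticToContinuum-14827`).  Setting as in file 1 (`…MesoOnePtShift`):
`E_{N+1-s}[χ(x₀)] = onePt P σ χ N s`, `E_{N+1}[χ(x₀)χ(x₁)] = twoPt P σ χ N`, a level-Lipschitz bound `δ` for the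
insertion ratios.  We prove:

* §1 `tpt_onePt_zero_eq_sum_add`: the one-point expectation expanded AROUND A SECOND PARTICLE —
  `E_{N+1}[χ(x₀)] = ∑_{j<N} C(N−1,j) W^χ(j+1) r_N(N+1,j+1) + same-block(χ,1)/Ξ` (the two-point decorated
  expansion `integral_two_point_eq` with the decoration `1` at `x₁`, `M^1 = Ξ`).
* §3 `tpt_abs_twoPt_sub_sq_le`: the TRUNCATED TWO-POINT FUNCTION —
  `|E_{N+1}[χ(x₀)χ(x₁)] − E_{N+1}[χ(x₀)]²| ≤ (∫|χ|dμ)·‖χ‖∞·(2eS(K₁/(N+1) + 2eSδ) + 8e²Sλ/(N+1))`: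
  subtract §1 times `E_{N+1}[χ]` from `LGFS.twoPt_eq_sum_add`; the main sum carries the shift differences of
  file 1 against the `L¹` coefficient bound `MesoLLN.abs_coefN_le_integral`; the two same-block remainders are
  `O(‖χ‖_{L¹(μ)} ‖·‖∞ λ/(N+1))` by `LGFS.abs_sameBlockRem_div_le_L1`.  LINEAR in `‖χ‖∞` — what a kernel of
  height `C(N+1)^{3γ}` and unit mass needs for Poisson order; with `δ = O(λ/(N+1))` the bound is
  `O(‖χ‖_{L¹(μ)}‖χ‖∞/(N+1))`.

For the uniform profile the shift differences vanish identically (`mesoVar_twoPt_uniform_sub_sq`, p148322).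
No definitions, no named facts; axioms standard.  References: E. Pulvirenti, D. Tsagkarogiannis, Comm. Math.
Phys. 316 (2012) §3–5; D. Ruelle, *Statistical Mechanics* (1969) §4.2.
-/

noncomputable section

namespace Summit.AtomisticToContinuum.HydrodynamicLimit.Theorems.MesoChebyshevWindow

open MeasureTheory Finset Filter Topology
open Literature.Probability.LatticeModels Literature.MathematicalPhysics.StatisticalMechanics
  Literature.MathematicalPhysics.KineticTheory

variable {P : DensityProfile} {σ : ℝ}

/-! ## §1 The one-point expectation expanded around a second particle -/

/-- **One-point expansion with a spectator.**  For `N + 1 ≥ 2` spheres and bounded measurable `χ`,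
`E_{N+1}[χ(x₀)] = ∑_{j<N} C(N−1,j) W^χ_N(j+1) r_N(N+1,j+1) + same-block(χ,1)/Ξ_N(N+1)`: the two-point
decorated expansion (`integral_two_point_eq`) with the decoration `1` at `x₁` — the block of `x₀` either
avoids `x₁` (then the complementary decorated partition function is `M^1 = Ξ`, `Md_one`) or contains it. -/
theorem tpt_onePt_zero_eq_sum_add (hs : SmallDensity P σ) {χ : T3 → ℝ} (hχ : Measurable χ) {C : ℝ}
    (hχC : ∀ y, |χ y| ≤ C) {N : ℕ} (h2 : 2 ≤ N + 1) :
    onePt P σ χ N 0 =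
      ∑ j ∈ range N, coefN P σ N χ (N - 1) j * rN P σ N (N + 1) (j + 1) +
        sameBlockRem P (hsDiameter σ N) (N + 1) h2 χ (fun _ => 1) / XiN P σ N (N + 1) := by
  have hlam1 := hs.ovDensity_lt_one
  have hXi := XiN_pos hs.σ_pos.le hs.σ_lt_half hlam1 (N := N) (m := N + 1) le_rfl
  have h1 : ∀ y : T3, |(fun _ : T3 => (1 : ℝ)) y| ≤ 1 := fun _ => by simp
  -- the left-hand side of the two-point expansion with decoration `1` at `x₁` is `M^χ(N+1)`
  have hL : ∫ x, χ (x 0) * (fun _ : T3 => (1 : ℝ)) (x ⟨1, h2⟩) * efR (Ov (hsDiameter σ N)) x univ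
      ∂Measure.pi (fun _ : Fin (N + 1) => P.μ) = Md P (hsDiameter σ N) (N + 1) χ (N + 1) := by
    rw [Md, decPF, firstLabels_self]
    exact integral_congr_ae (ae_of_all _ fun x => by simp only [mul_one])
  have hexp := integral_two_point_eq (P := P) (ε := hsDiameter σ N) (n := N + 1) h2 hχ measurable_const hχC h1
  rw [hL] at hexp
  have honePt : onePt P σ χ N 0 = Md P (hsDiameter σ N) (N + 1) χ (N + 1) / XiN P σ N (N + 1) := by
    simp only [onePt, Nat.sub_zero]
  rw [honePt, hexp, add_div, sum_div]
  congr 1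
  simp only [Nat.add_sub_cancel, Md_one]
  refine sum_congr rfl fun j hj => ?_
  have hj' := mem_range.mp hj
  have hXij := XiN_pos hs.σ_pos.le hs.σ_lt_half hlam1 (N := N) (m := N - j) (by omega)
  simp only [coefN, rN, XiN]
  rw [show N + 1 - 2 = N - 1 by omega, show N + 1 - (j + 1) = N - j by omega]
  rw [XiN] at hXij hXi
  field_simp

/-! ## §3 The truncated two-point function -/

/-- **Quantitative truncated two-point function of the canonical hard-sphere gas with a slowly varying
one-body law.**  At small density, for `N ≥ 1`, bounded measurable `χ` (`|χ| ≤ C`, `I = ∫|χ| dμ`) and a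
level-Lipschitz bound `δ` for the insertion ratios:
`|E_{N+1}[χ(x₀)χ(x₁)] − E_{N+1}[χ(x₀)]²| ≤ I·C·(2eS·(K₁/(N+1) + 2eSδ) + 8e²Sλ/(N+1))`,
`K₁ = 4e²λS + 2eθ/(1−θ)²`, `S = θ/(1−θ)² + (1−θ)⁻¹`.  With `δ = O(λ/(N+1))` (`…MesoRatioLipschitz`) this is
`O(‖χ‖_{L¹(μ)} ‖χ‖∞ /(N+1))` — linear in the sup norm.  Proof: `LGFS.twoPt_eq_sum_add` minus `E_{N+1}[χ]` times
`tpt_onePt_zero_eq_sum_add` leaves `∑_j C(N−1,j)W^χ(j+1) r_N(N+1,j+1)·(E_{N-j}[χ] − E_{N+1}[χ])` (shift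
differences `≤ (j+1)C(K₁/(N+1) + 2eSδ)` by `tpt_onePt_shift_le`, coefficients `≤ 2eIθʲ` by the `L¹` tree bound)
plus the two same-block remainders (`LGFS.abs_sameBlockRem_div_le_L1`, each `O(I λ/(N+1))`). -/
theorem tpt_abs_twoPt_sub_sq_le (hs : SmallDensity P σ) {χ : T3 → ℝ} (hχ : Measurable χ) {C : ℝ}
    (hχC : ∀ y, |χ y| ≤ C) {N : ℕ} (hN : 1 ≤ N) {δ : ℝ} (hδ : 0 ≤ δ)
    (hq : ∀ k, k + 1 ≤ N → |qN P σ N (k + 1) - qN P σ N k| ≤ δ) :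
    |twoPt P σ χ N - onePt P σ χ N 0 ^ 2| ≤
      (∫ y, |χ y| ∂P.μ) * C *
        (2 * Real.exp 1 * (geomRatio P σ / (1 - geomRatio P σ) ^ 2 + (1 - geomRatio P σ)⁻¹) *
            ((4 * Real.exp 1 ^ 2 * ovDensity P σ *
                  (geomRatio P σ / (1 - geomRatio P σ) ^ 2 + (1 - geomRatio P σ)⁻¹) +
                2 * Real.exp 1 * (geomRatio P σ / (1 - geomRatio P σ) ^ 2)) / ((N : ℝ) + 1) +
              2 * Real.exp 1 * (geomRatio P σ / (1 - geomRatio P σ) ^ 2 + (1 - geomRatio P σ)⁻¹) * δ) +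
          8 * Real.exp 1 ^ 2 * (geomRatio P σ / (1 - geomRatio P σ) ^ 2 + (1 - geomRatio P σ)⁻¹) *
            ovDensity P σ / ((N : ℝ) + 1)) := by
  have hσ := hs.σ_pos.le
  have hσ2 := hs.σ_lt_half
  have hlam1 := hs.ovDensity_lt_one
  have hl0 := hs.ovDensity_nonneg
  have hθ0 := hs.geomRatio_nonneg
  have hθ1 := hs.geomRatio_lt_one
  have hC : 0 ≤ C := (abs_nonneg _).trans (hχC 0)
  have hN0 : (0 : ℝ) < (N : ℝ) + 1 := by positivity
  have hS0 := tpt_S_nonneg hs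
  have h2 : 2 ≤ N + 1 := by omega
  have h1 : ∀ y : T3, |(fun _ : T3 => (1 : ℝ)) y| ≤ 1 := fun _ => by simp
  set θ := geomRatio P σ with hθ
  set S := geomRatio P σ / (1 - geomRatio P σ) ^ 2 + (1 - geomRatio P σ)⁻¹ with hS
  set I := ∫ y, |χ y| ∂P.μ with hI
  have hI0 : 0 ≤ I := integral_nonneg fun _ => abs_nonneg _
  set L : ℝ := C * ((4 * Real.exp 1 ^ 2 * ovDensity P σ * S + 2 * Real.exp 1 * (θ / (1 - θ) ^ 2)) /
      ((N : ℝ) + 1) + 2 * Real.exp 1 * S * δ) with hL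
  have hL0 : 0 ≤ L := by
    rw [hL]
    have : 0 < 1 - θ := by linarith
    positivity
  set p := pOv P (hsDiameter σ N) with hpdef
  have hp0 : 0 ≤ p := pOv_nonneg P (hsDiameter_nonneg' hσ N)
  have hp : p = ovDensity P σ / ((N : ℝ) + 1) := by
    rw [hpdef, pOv_hsDiameter]; push_cast; ring
  set m := onePt P σ χ N 0 with hm
  have hmC : |m| ≤ C := hs.abs_onePt_le hχ hχC N 0
  set Rχχ := sameBlockRem P (hsDiameter σ N) (N + 1) h2 χ χ / XiN P σ N (N + 1) with hRχχ
  set Rχ1 := sameBlockRem P (hsDiameter σ N) (N + 1) h2 χ (fun _ => 1) / XiN P σ N (N + 1) with hRχ1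
  -- the two expansions
  have hT := LGFS.twoPt_eq_sum_add hs hχ hχC h2
  have hO := tpt_onePt_zero_eq_sum_add hs hχ hχC h2
  rw [← hRχχ] at hT
  rw [← hRχ1, ← hm] at hO
  -- the decomposition
  have hsplit : ∑ j ∈ range N, coefN P σ N χ (N - 1) j * rN P σ N (N + 1) (j + 1) *
        (onePt P σ χ N (j + 1) - m) =
      ∑ j ∈ range N, coefN P σ N χ (N - 1) j * onePt P σ χ N (j + 1) * rN P σ N (N + 1) (j + 1) -
        m * ∑ j ∈ range N, coefN P σ N χ (N - 1) j * rN P σ N (N + 1) (j + 1) := by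
    rw [mul_sum, ← sum_sub_distrib]
    exact sum_congr rfl fun j _ => by ring
  have hdec : twoPt P σ χ N - m ^ 2 =
      ∑ j ∈ range N, coefN P σ N χ (N - 1) j * rN P σ N (N + 1) (j + 1) *
        (onePt P σ χ N (j + 1) - m) + (Rχχ - m * Rχ1) := by
    rw [hsplit]
    linear_combination hT + (-m) * hO
  -- the main sum
  have hmain : |∑ j ∈ range N, coefN P σ N χ (N - 1) j * rN P σ N (N + 1) (j + 1) *
        (onePt P σ χ N (j + 1) - m)| ≤ 2 * Real.exp 1 * I * L * S := by
    have hshift := tpt_onePt_shift_le hs hχ hχC (N := N) hδ hq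
    have hterm : ∀ j ∈ range N,
        |coefN P σ N χ (N - 1) j * rN P σ N (N + 1) (j + 1) * (onePt P σ χ N (j + 1) - m)| ≤
          2 * Real.exp 1 * I * L * (((j : ℝ) + 1) * θ ^ j) := by
      intro j hj
      have hj' := mem_range.mp hj
      have hco := MesoLLN.abs_coefN_le_integral (P := P) hσ hσ2 hχ hχC (N := N) (m := N - 1) (j := j)
        (by omega) (by omega)
      have hr0 : 0 ≤ rN P σ N (N + 1) (j + 1) :=
        zero_le_one.trans (one_le_rN hσ hσ2 hlam1 le_rfl (by omega))
      have hr2 : rN P σ N (N + 1) (j + 1) ≤ 2 ^ (j + 1) := hs.rN_le_two_pow le_rfl (by omega)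
      have hsh := hshift (j + 1) (by omega)
      rw [← hm] at hsh
      rw [abs_mul, abs_mul, abs_of_nonneg hr0]
      calc |coefN P σ N χ (N - 1) j| * rN P σ N (N + 1) (j + 1) * |onePt P σ χ N (j + 1) - m|
          ≤ (I * (Real.exp 1 * (Real.exp 1 * ovDensity P σ) ^ j)) * 2 ^ (j + 1) *
              (((j + 1 : ℕ) : ℝ) * L) :=
            mul_le_mul (mul_le_mul hco hr2 hr0 (by positivity)) hsh (abs_nonneg _) (by positivity)
        _ = 2 * Real.exp 1 * I * L * (((j : ℝ) + 1) * θ ^ j) := by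
            rw [hθ, geomRatio]; push_cast; ring
    calc |∑ j ∈ range N, coefN P σ N χ (N - 1) j * rN P σ N (N + 1) (j + 1) * (onePt P σ χ N (j + 1) - m)|
        ≤ ∑ j ∈ range N, |coefN P σ N χ (N - 1) j * rN P σ N (N + 1) (j + 1) * (onePt P σ χ N (j + 1) - m)| :=
          abs_sum_le_sum_abs _ _
      _ ≤ ∑ j ∈ range N, 2 * Real.exp 1 * I * L * (((j : ℝ) + 1) * θ ^ j) := sum_le_sum hterm
      _ = 2 * Real.exp 1 * I * L * ∑ j ∈ range N, ((j : ℝ) + 1) * θ ^ j := by rw [mul_sum]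
      _ ≤ 2 * Real.exp 1 * I * L * S :=
          mul_le_mul_of_nonneg_left (tpt_sum_succ_mul_pow_le hs N) (by positivity)
  -- the remainders
  have hR1 : |Rχχ| ≤ 4 * Real.exp 1 ^ 2 * (I * C) * S * p := by
    have h := LGFS.abs_sameBlockRem_div_le_L1 hs hχ hχ hχC hχC N h2
    rwa [← hRχχ, ← hI, ← hS, ← hpdef] at h
  have hR2 : |Rχ1| ≤ 4 * Real.exp 1 ^ 2 * (I * 1) * S * p := by
    have h := LGFS.abs_sameBlockRem_div_le_L1 hs hχ measurable_const hχC h1 N h2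
    rwa [← hRχ1, ← hI, ← hS, ← hpdef] at h
  have hrem : |Rχχ - m * Rχ1| ≤ 8 * Real.exp 1 ^ 2 * I * C * S * p := by
    calc |Rχχ - m * Rχ1| ≤ |Rχχ| + |m * Rχ1| := abs_sub _ _
      _ = |Rχχ| + |m| * |Rχ1| := by rw [abs_mul]
      _ ≤ 4 * Real.exp 1 ^ 2 * (I * C) * S * p + C * (4 * Real.exp 1 ^ 2 * (I * 1) * S * p) :=
          add_le_add hR1 (mul_le_mul hmC hR2 (abs_nonneg _) hC)
      _ = 8 * Real.exp 1 ^ 2 * I * C * S * p := by ring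
  -- assembly
  rw [hdec]
  calc |∑ j ∈ range N, coefN P σ N χ (N - 1) j * rN P σ N (N + 1) (j + 1) * (onePt P σ χ N (j + 1) - m) +
        (Rχχ - m * Rχ1)|
      ≤ |∑ j ∈ range N, coefN P σ N χ (N - 1) j * rN P σ N (N + 1) (j + 1) * (onePt P σ χ N (j + 1) - m)| +
          |Rχχ - m * Rχ1| := abs_add_le _ _
    _ ≤ 2 * Real.exp 1 * I * L * S + 8 * Real.exp 1 ^ 2 * I * C * S * p := add_le_add hmain hrem
    _ = _ := by rw [hp, hL]; ring

/-- **Quantitative truncated two-point function, closed form** (registered helper statement of the line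
`meso-chebyshev-window`; = `tpt_abs_twoPt_sub_sq_le`): at small density, `N ≥ 1`, `|χ| ≤ C`, given a level-Lipschitz
bound `δ` for the insertion ratios, `|E_{N+1}[χ(x₀)χ(x₁)] − E_{N+1}[χ(x₀)]²| ≤ (∫|χ|dμ)·C·(2eS(K₁/(N+1) + 2eSδ) + 8e²Sλ/(N+1))`. -/
theorem twoPtTruncatedBound : ∀ (P : DensityProfile) (σ : ℝ), SmallDensity P σ → ∀ (χ : T3 → ℝ) (C : ℝ), Measurable χ → (∀ y, |χ y| ≤ C) → ∀ (N : ℕ), 1 ≤ N → ∀ (δ : ℝ), 0 ≤ δ → (∀ k, k + 1 ≤ N → |qN P σ N (k + 1) - qN P σ N k| ≤ δ) → |twoPt P σ χ N - onePt P σ χ N 0 ^ 2| ≤ (∫ y, |χ y| ∂P.μ) * C * (2 * Real.exp 1 * (geomRatio P σ / (1 - geomRatio P σ) ^ 2 + (1 - geomRatio P σ)⁻¹) * ((4 * Real.exp 1 ^ 2 * ovDensity P σ * (geomRatio P σ / (1 - geomRatio P σ) ^ 2 + (1 - geomRatio P σ)⁻¹) + 2 * Real.exp 1 * (geomRatio P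 σ / (1 - geomRatio P σ) ^ 2)) / ((N : ℝ) + 1) + 2 * Real.exp 1 * (geomRatio P σ / (1 - geomRatio P σ) ^ 2 + (1 - geomRatio P σ)⁻¹) * δ) + 8 * Real.exp 1 ^ 2 * (geomRatio P σ / (1 - geomRatio P σ) ^ 2 + (1 - geomRatio P σ)⁻¹) * ovDensity P σ / ((N : ℝ) + 1)) :=
  fun _ _ hs _ _ hχ hχC _ hN _ hδ hq => tpt_abs_twoPt_sub_sq_le hs hχ hχC hN hδ hq

end Summit.AtomisticToContinuum.HydrodynamicLimit.Theorems.MesoChebyshevWindow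

end
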